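import Literature.AnabelianGeometry.EtaleTheta.ThetaCoversMonodromyModelTheta
import HarnessLib

/-!
# The MONODROMY MODEL of the tempered theta-covering interface ([EtTh] §2), part 3: the tempered layer of
# Def. 2.5 and the inhabitant `monodromyModel l hl : TemperedCoverData l`

S. Mochizuki, *The étale theta function and its Frobenioid-theoretic manifestations* [EtTh], Publ. RIMS **45**
(2009), §1 p. 12 («the natural quotient `Π^tp_X ↠ Z`», `Π_X := (Π^tp_X)^∧`), §2 Def. 2.5 (PDF pp. 39–40)
[cite: MochizukiEtTh2009, Def 2.5 p.39].  Cell abc-iut, layer L2, seat abc-iut-w6-d084 (gen 7), «P26-NV MONODROMY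
TOY» STAGE 1 FILE 2b (abc-iut-L2-lead R1352 GO STAGED).  Sequel of parts 1–2 (`ThetaCoversMonodromyModelDefs.lean`:
`TG l = ((ℤ/l × ℤ/l) ⋊ D_∞) × ℤ/2`, `Π_C := (TG l)^∧`, `Φ`; `ThetaCoversMonodromyModelTheta.lean`: `coverDataAx'`,
`Π_{C̲̲} = PiCuuM` of type `(1, l-torsΘ)±`).  DEF-BEARING (class (b) MODEL/CONSTRUCTION; no frozen structure touched;
the interface `ThetaCovers.TemperedCoverData` of abc-iut-L2-t2 is INSTANTIATED, not edited).

HONEST LABEL (R1352): a DESIGNED tempered toy with print's monodromy combinatorics — loop ↦ `Δ̄^ell` (`b`-cycle), the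
inversion INVERTS it, unipotent monodromy `x ↦ x·z` on the `a`-cycle, `z` = cusp inertia = `Δ̄_Θ` central;
`G_K := 1`; NOT a Tate curve, NOT the tempered fundamental group of a curve; consistency ≠ faithfulness; nothing here
takes a side on anything printed.

CONTENT.  §1 The tempered subgroups of `Π^tp_C := TG l` in coordinates `g = ((v, d), e)`, `v ∈ (ℤ/l)²`, `d ∈ D_∞`,
`e ∈ ℤ/2`: `Π^tp_Y := {d = 1}` (`PiYT`), `Π^tp_Ÿ := {d = 1, e = 1}` (`PiYddT`, index `2` in `Π^tp_Y`),
`Π^tp_Ċ := {e = 1}` (`PiCdotT`, index `2`), and `Π^tp_X = toHat⁻¹(Π_X) = {d a rotation}` with the ROTATION INDEX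
`Π^tp_X ↠ ℤ`, `r^i ↦ i` (`rotDeg`), kernel `Π^tp_Y` — «`Π^tp_X/Π^tp_Y = Z ≅ ℤ`» (§1 p. 12) realised by the loop
`t = r 1` of infinite order.  §2 **`monodromyModel l hl : TemperedCoverData l`** for every odd `l`: profinite part
`coverDataAx' l hl`, `Π_{C̲̲} := PiCuuM l`, `toHat := η : TG l ↪ (TG l)^∧` (injective, a profinite completion).
Sequel (STAGE 2, after the R1352 checkpoint): the members of the tower of Prop. 2.4 / Def. 2.5 (ii) in coordinates
and the typed Prop. 2.4 / Prop. 2.6 AT THE MODEL.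
-/

noncomputable section

namespace Literature.AnabelianGeometry.EtaleTheta.ThetaCovers.MonodromyModel

open Multiplicative HeisenbergWitness TemperedModel Literature.AnabelianGeometry.SemiGraphs

variable (l : ℕ)

/-! ## 1. The tempered subgroups of `TG l` -/

/-- Second projection `TG l → ℤ/2` (the `Ÿ`-sheet character; its kernel is `Π^tp_Ċ`). (toy bookkeeping for the
typed interface of [EtTh] Def. 2.5; no claim about print) [cite: MochizukiEtTh2009, Def 2.5 p.39] -/
def TG.snd : TG l →* Multiplicative (ZMod 2) := MonoidHom.snd (TG₀ l) (Multiplicative (ZMod 2))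

/-- The projection `TG l ↠ D_∞`. (toy bookkeeping; no claim about print) [cite: MochizukiEtTh2009, §1 p.12] -/
def TG.dih : TG l →* DihedralGroup 0 := SemidirectProduct.rightHom.comp (TG.fst l)

/-- `TG.dih g = g.1.right`. (toy bookkeeping; no claim about print) [cite: MochizukiEtTh2009, §1 p.12] -/
@[simp] theorem TG.dih_apply (g : TG l) : TG.dih l g = g.1.right := rfl

/-- `Φ ∘ toHat` in coordinates: `TG l → heisPiC l`, `((v, d), e) ↦ (v, d mod l)`. (toy bookkeeping; no claim about
print) [cite: MochizukiEtTh2009, Def 2.1 p.36] -/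
def PhiT : TG l →* heisPiC l := (sh₀ l).comp (TG.fst l)

/-- `Φ ∘ η = PhiT`. (toy bookkeeping; no claim about print) [cite: MochizukiEtTh2009, Def 2.1 p.36] -/
theorem Phi_comp_toHat [NeZero l] : (Phi l).comp (toHat l).toMonoidHom = PhiT l :=
  MonoidHom.ext fun g => Phi_toHat l g

/-- Pull-backs along `toHat` of pull-backs along `Φ` are pull-backs along `PhiT`. (toy bookkeeping; no claim about
print) [cite: MochizukiEtTh2009, Prop 2.4 p.38] -/
theorem comap_toHat_comap_Phi [NeZero l] (A : Subgroup (heisPiC l)) :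
    (A.comap (Phi l)).comap (toHat l).toMonoidHom = A.comap (PhiT l) := by
  rw [Subgroup.comap_comap, Phi_comp_toHat]

/-- `dihedralRed d` is a rotation iff `d` is. (toy bookkeeping; no claim about print) [cite: MochizukiEtTh2009, §1 p.12] -/
theorem exists_dihedralRed_eq_r_iff (n : ℕ) (d : DihedralGroup 0) :
    (∃ i, dihedralRed n d = DihedralGroup.r i) ↔ ∃ j, d = DihedralGroup.r j := by
  rcases d with j | j
  · exact ⟨fun _ => ⟨j, rfl⟩, fun _ => ⟨_, dihedralRed_r n j⟩⟩
  · refine ⟨?_, ?_⟩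
    · rintro ⟨i, hi⟩
      rw [dihedralRed_sr] at hi
      cases hi
    · rintro ⟨i, hi⟩
      cases hi

/-- **`Π^tp_X = PhiT⁻¹(heisPiX) = {d a rotation}`.** (toy bookkeeping for the typed interface of [EtTh] Def. 2.5;
no claim about print) [cite: MochizukiEtTh2009, Def 2.5 p.39] -/
theorem mem_comap_PhiT_heisPiX {g : TG l} :
    g ∈ (heisPiX l).comap (PhiT l) ↔ ∃ j, g.1.right = DihedralGroup.r j := by
  rw [Subgroup.mem_comap, mem_heisPiX]
  exact exists_dihedralRed_eq_r_iff l g.1.right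

/-- **`Π^tp_Y := Ker(TG l ↠ D_∞) = (ℤ/l)² × ℤ/2`** («the natural quotient `Π^tp_X ↠ Z`», §1 p. 12: `Z` is realised by
the rotation index). (toy bookkeeping for the typed interface of [EtTh] Def. 2.5; no claim about print)
[cite: MochizukiEtTh2009, Def 2.5 p.39] -/
abbrev PiYT : Subgroup (TG l) := (TG.dih l).ker

/-- Membership in `Π^tp_Y`. (toy bookkeeping; no claim about print) [cite: MochizukiEtTh2009, Def 2.5 p.39] -/
theorem mem_PiYT {g : TG l} : g ∈ PiYT l ↔ g.1.right = 1 := MonoidHom.mem_ker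

/-- **`Π^tp_Ÿ := {d = 1, e = 1} = (ℤ/l)²`** (index `2` in `Π^tp_Y`; «`Ÿ = Y₂`», p. 17). (toy bookkeeping for the typed
interface of [EtTh] Def. 2.5; no claim about print) [cite: MochizukiEtTh2009, Def 2.5 p.39] -/
abbrev PiYddT : Subgroup (TG l) := PiYT l ⊓ (TG.snd l).ker

/-- **`Π^tp_Ċ := Ker(TG l ↠ ℤ/2) = (ℤ/l × ℤ/l) ⋊ D_∞`** (index `2`, contains `ι`, not `e`). (toy bookkeeping for the
typed interface of [EtTh] Def. 2.5 (ii) / Def. 1.7; no claim about print) [cite: MochizukiEtTh2009, Def 2.5 p.39] -/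
abbrev PiCdotT : Subgroup (TG l) := (TG.snd l).ker

/-- Membership in `Π^tp_Ċ`. (toy bookkeeping; no claim about print) [cite: MochizukiEtTh2009, Def 2.5 p.39] -/
theorem mem_PiCdotT {g : TG l} : g ∈ PiCdotT l ↔ g.2 = 1 := MonoidHom.mem_ker

/-- `TG.snd` is surjective. (toy bookkeeping; no claim about print) [cite: MochizukiEtTh2009, Def 2.5 p.39] -/
theorem TG.snd_surjective : Function.Surjective (TG.snd l) := fun e => ⟨((1 : TG₀ l), e), rfl⟩

/-- `[Π^tp_C : Π^tp_Ċ] = 2`. (toy bookkeeping; no claim about print) [cite: MochizukiEtTh2009, Def 2.5 p.39] -/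
theorem index_PiCdotT : (PiCdotT l).index = 2 := by
  rw [Subgroup.index_ker, MonoidHom.range_eq_top.mpr (TG.snd_surjective l), Subgroup.card_top,
    Nat.card_eq_fintype_card, Fintype.card_multiplicative, ZMod.card]

/-- `[Π^tp_Y : Π^tp_Ÿ] = 2` (the sheet character restricted to `Π^tp_Y` is onto `ℤ/2`). (toy bookkeeping; no claim
about print) [cite: MochizukiEtTh2009, Def 2.5 p.39] -/
theorem relIndex_PiYddT : (PiYddT l).relIndex (PiYT l) = 2 := by
  rw [Subgroup.inf_relIndex_left]
  have hs : Function.Surjective ((TG.snd l).comp (PiYT l).subtype) := by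
    intro e
    exact ⟨⟨((1 : TG₀ l), e), (mem_PiYT l).mpr rfl⟩, rfl⟩
  have hker : ((TG.snd l).comp (PiYT l).subtype).ker = (TG.snd l).ker.subgroupOf (PiYT l) := rfl
  rw [Subgroup.relIndex, ← hker, Subgroup.index_ker, MonoidHom.range_eq_top.mpr hs, Subgroup.card_top,
    Nat.card_eq_fintype_card, Fintype.card_multiplicative, ZMod.card]

/-- `ι = s ∈ Π^tp_Ċ`. (toy bookkeeping; no claim about print) [cite: MochizukiEtTh2009, Def 2.5 p.39] -/
theorem iotaT_mem_PiCdotT : iotaT l ∈ PiCdotT l := (mem_PiCdotT l).mpr rfl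

/-- `ι = s ∉ Π^tp_X`. (toy bookkeeping; no claim about print) [cite: MochizukiEtTh2009, Def 2.5 p.39] -/
theorem iotaT_not_mem_comap_PhiT : iotaT l ∉ (heisPiX l).comap (PhiT l) := by
  rw [mem_comap_PhiT_heisPiX]
  rintro ⟨j, hj⟩
  change DihedralGroup.sr 0 = DihedralGroup.r j at hj
  cases hj

/-- The rotation index `D_∞ → ℤ` (`r^i ↦ i`; junk `i` on reflections) — «`Π^tp_X/Π^tp_Y = Z`». (toy bookkeeping for
[EtTh] §1 p. 12; no claim about print) [cite: MochizukiEtTh2009, §1 p.12] -/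
def rotIdx₀ : DihedralGroup 0 → Multiplicative ℤ
  | DihedralGroup.r i => ofAdd (show ℤ from i)
  | DihedralGroup.sr i => ofAdd (show ℤ from i)

/-- `rotIdx₀ (r i) = ofAdd i`. (toy bookkeeping; no claim about print) [cite: MochizukiEtTh2009, §1 p.12] -/
@[simp] theorem rotIdx₀_r (i : ZMod 0) : rotIdx₀ (DihedralGroup.r i) = ofAdd (show ℤ from i) := rfl

/-- **The degree `Π^tp_X ↠ ℤ`** (rotation index of the `D_∞`-component), a homomorphism on `Π^tp_X = {d a rotation}`.
(toy bookkeeping for [EtTh] §1 p. 12 «`Π^tp_X ↠ Z`»; no claim about print) [cite: MochizukiEtTh2009, §1 p.12] -/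
def rotDeg : ↥((heisPiX l).comap (PhiT l)) →* Multiplicative ℤ where
  toFun g := rotIdx₀ (g : TG l).1.right
  map_one' := by
    change rotIdx₀ (1 : DihedralGroup 0) = 1
    rw [DihedralGroup.one_def, rotIdx₀_r]
    rfl
  map_mul' g h := by
    obtain ⟨i, hi⟩ := (mem_comap_PhiT_heisPiX l).mp g.2
    obtain ⟨j, hj⟩ := (mem_comap_PhiT_heisPiX l).mp h.2
    change rotIdx₀ ((g : TG l) * h).1.right = rotIdx₀ (g : TG l).1.right * rotIdx₀ (h : TG l).1.right
    rw [show ((g : TG l) * h).1.right = (g : TG l).1.right * (h : TG l).1.right from rfl, hi, hj,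
      DihedralGroup.r_mul_r, rotIdx₀_r, rotIdx₀_r, rotIdx₀_r, ← ofAdd_add]
    rfl

/-- `rotDeg` is surjective (`t^n = r^n ↦ n`). (toy bookkeeping; no claim about print) [cite: MochizukiEtTh2009, §1 p.12] -/
theorem rotDeg_surjective : Function.Surjective (rotDeg l) := by
  intro n
  refine ⟨⟨((SemidirectProduct.inr (DihedralGroup.r (show ZMod 0 from toAdd n)) : TG₀ l),
    (1 : Multiplicative (ZMod 2))), (mem_comap_PhiT_heisPiX l).mpr ⟨_, rfl⟩⟩, ?_⟩
  change rotIdx₀ (DihedralGroup.r _) = n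
  rw [rotIdx₀_r]
  exact ofAdd_toAdd n

/-- `Ker(rotDeg) = Π^tp_Y`. (toy bookkeeping; no claim about print) [cite: MochizukiEtTh2009, §1 p.12] -/
theorem rotDeg_ker : (rotDeg l).ker = (PiYT l).subgroupOf ((heisPiX l).comap (PhiT l)) := by
  ext g
  obtain ⟨i, hi⟩ := (mem_comap_PhiT_heisPiX l).mp g.2
  rw [MonoidHom.mem_ker, Subgroup.mem_subgroupOf, mem_PiYT, hi, DihedralGroup.one_def]
  change rotIdx₀ (g : TG l).1.right = 1 ↔ _
  rw [hi, rotIdx₀_r, ← ofAdd_zero, ofAdd.apply_eq_iff_eq]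
  exact ⟨fun h => congrArg DihedralGroup.r h, fun h => by injection h⟩

/-- **`Π^tp_X / Π^tp_Y ≅ ℤ`** at the model («`Π^tp_X ↠ Z`», §1 p. 12). (toy bookkeeping; no claim about print)
[cite: MochizukiEtTh2009, §1 p.12] -/
theorem nonempty_quotZ :
    Nonempty (↥((heisPiX l).comap (PhiT l)) ⧸ (PiYT l).subgroupOf ((heisPiX l).comap (PhiT l)) ≃* Multiplicative ℤ) := by
  haveI : ((PiYT l).subgroupOf ((heisPiX l).comap (PhiT l))).Normal := by rw [← rotDeg_ker]; infer_instance
  exact ⟨(QuotientGroup.quotientMulEquivOfEq (rotDeg_ker l).symm).trans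
    (QuotientGroup.quotientKerEquivOfSurjective (rotDeg l) (rotDeg_surjective l))⟩

/-! ## 2. The inhabitant of `TemperedCoverData l` -/

variable [NeZero l]

/-- `toHat⁻¹(Π_X) = PhiT⁻¹(heisPiX)` for the model's `Π_X = Φ⁻¹(heisPiX)`. (toy bookkeeping; no claim about print)
[cite: MochizukiEtTh2009, Def 2.5 p.39] -/
theorem comap_toHat_PiX (hl : Odd l) :
    (coverDataAx' l hl).PiX.comap (toHat l).toMonoidHom = (heisPiX l).comap (PhiT l) :=
  comap_toHat_comap_Phi l (heisPiX l)

/-- **THE MONODROMY MODEL**: an inhabitant of abc-iut-L2-t2's interface `TemperedCoverData l` (Def. 2.5) for every odd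
`l`, with `Π^tp_C := ((ℤ/l × ℤ/l) ⋊ D_∞) × ℤ/2` DISCRETE, densely and injectively embedded in its profinite completion
`Π_C`, `Π^tp_Y = (ℤ/l)² × ℤ/2`, `Π^tp_X/Π^tp_Y ≅ ℤ` by the rotation index, `Π^tp_Ÿ = (ℤ/l)²`, `Π^tp_Ċ = Ker(e)`,
`Π_{C̲̲} = (Ker Φ ⊔ Φ⁻¹⟨r⟩) ⊔ ⟨ι⟩`, `G_K = 1`.  CONSISTENCY WITNESS ONLY (honest label in the file header).
[cite: MochizukiEtTh2009, Def 2.5 p.39] -/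
@[reducible] def monodromyModel (hl : Odd l) : TemperedCoverData.{0} l where
  toCoverDataAx := coverDataAx' l hl
  PiCuu := PiCuuM l
  isTypeLTorsThetaPm := isTypeLTorsThetaPm_PiCuuM l hl
  isOpen_PiCuu' := isOpen_PiCuuM l
  Gtp := TG l
  grpTp := inferInstance
  topTp := inferInstance
  tgTp := inferInstance
  toHat := (toHat l).toMonoidHom
  continuous_toHat := (toHat l).continuous
  injective_toHat := toHat_injective l
  isProfiniteCompletion_toHat := isProfiniteCompletion_toHat l
  PiYtp := PiYT l
  PiYtp_le := by
    rw [comap_toHat_PiX]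
    intro g hg
    exact (mem_comap_PhiT_heisPiX l).mpr ⟨0, by rw [(mem_PiYT l).mp hg, DihedralGroup.one_def]⟩
  PiYtp_normal := MonoidHom.normal_ker _
  isOpen_PiYtp := isOpen_discrete _
  quotZ := by rw [comap_toHat_PiX]; exact nonempty_quotZ l
  PiYddtp := PiYddT l
  PiYddtp_le := inf_le_left
  isOpen_PiYddtp := isOpen_discrete _
  relIndex_PiYddtp := relIndex_PiYddT l
  PiCdot := PiCdotT l
  index_PiCdot := index_PiCdotT l
  isOpen_PiCdot := isOpen_discrete _
  PiCdot_ne := by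
    rw [comap_toHat_PiX]
    intro h
    exact iotaT_not_mem_comap_PhiT l (h ▸ iotaT_mem_PiCdotT l)

/-- **The interface `TemperedCoverData l` is inhabited by the monodromy model** for every odd `l` (CONSISTENCY WITNESS;
the tree's earlier inhabitant is abc-iut-w5-d118's `TemperedModel.exists_model`, at which the typed Prop. 2.4 / 2.6 FAIL).
[cite: MochizukiEtTh2009, Def 2.5 p.39] -/
theorem exists_temperedCoverData (hl : Odd l) : ∃ T : TemperedCoverData.{0} l, T = monodromyModel l hl := ⟨_, rfl⟩

end Literature.AnabelianGeometry.EtaleTheta.ThetaCovers.MonodromyModel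

end
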